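/-
Width seat `ym-line-cbag-p1-w3` (prover-ym-line-cbag-p1-w3-g8-0), the only seat on LINE 3 `route-QuantumFields-SixPlaneColdBox`: the crux
`TorusMeanNearColdBoxG` (stmt-QuantumFields-25708) REDUCED to its stub 1 alone — the registered composition `TorusMeanNearColdBoxG_of` of the
birth skeleton with stub 2 DISCHARGED by the landed `SixPlaneColdBox.nestedBoxMeansAgreeG` (ceiling `1/200`).
-/
import Summits.QuantumFields.YangMills.Theorems.SixPlaneColdBoxFlatBoxMeanG
import Summits.QuantumFields.YangMills.Theses.SixPlaneColdBox

/-!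
# Crux `TorusMeanNearColdBoxG` (stmt-QuantumFields-25708) from its infrared stub alone

The birth skeleton of crux `TorusMeanNearColdBoxG` (`bc/TorusMeanNearColdBoxG_birth.lean`, planner ym-idea-2 g2) composes two stubs:
stub 1 `stub_torusMeanNearTopBoxG` (the infrared input at ONE polynomial scale `⌈β^θ₁⌉`: torus plaquette mean − centre-plaquette mean of the top
cold box `≤ β^{−(1+4A+m)}` for every `0 < A < θ₁`) and stub 2 `stub_nestedBoxMeansAgreeG` (nested cold boxes agree).  Stub 2 is LANDED at the
ceiling `θ' ≤ 1/200` of the sharp mean engine (`SixPlaneColdBox.nestedBoxMeansAgreeG`, `Theorems/SixPlaneColdBoxFlatBoxMeanG.lean`; the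
skeleton prints `1/100`, but its `θ₁` is chosen by the prover of stub 1).  This file records the consequence:

* `torusMeanNearColdBoxG_of_topBox` — stub 1 with ceiling `θ₁ ≤ 1/200` ALONE implies the crux `Theses.SixPlaneColdBox.TorusMeanNearColdBoxG`
  (verbatim the skeleton's `TorusMeanNearColdBoxG_of`, margins merged by `two_rpow_le`).

So LINE 3 (`SixPlaneColdBox`: 25709 `DensityTransferG` ✓, 25710 `Assembly` ✓) hinges on exactly one statement, the one-scale infrared input.
No sorry; no definition; standard axioms.  A CONDITIONAL reduction (hypothesis = the open stub); NOT the Yang–Mills mass gap (RECORD-type node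
`LatticeNonFreezing`).
-/

set_option autoImplicit false

noncomputable section

open MeasureTheory
open Literature.MathematicalPhysics.QuantumLattice
open Literature.MathematicalPhysics.QuantumFieldTheory
open Summit.QuantumFields.YangMills.Theorems.WeakCouplingRates
open Summit.QuantumFields.YangMills.Theses.SixPlaneColdBox (TorusMeanNearColdBoxG)

namespace Summit.QuantumFields.YangMills.Theorems.SixPlaneColdBox

/-- Margin bookkeeping (the skeleton's `two_rpow_le`): two error terms with margins `m₁, m₂` fit under one with margin `min m₁ m₂ / 2`, for
`β ≥ 4 ^ (2 / min m₁ m₂)`. -/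
theorem two_rpow_le {β A m₁ m₂ : ℝ} (h₁ : 0 < m₁) (h₂ : 0 < m₂) (hβ1 : 1 ≤ β) (hβ : (4 : ℝ) ^ (2 / min m₁ m₂) ≤ β) :
    β ^ (-(1 + 4 * A + m₁)) + β ^ (-(1 + 4 * A + m₂)) ≤ β ^ (-(1 + 4 * A + min m₁ m₂ / 2)) := by
  have hβ0 : 0 < β := by linarith
  set m := min m₁ m₂ with hm
  have hmpos : 0 < m := lt_min h₁ h₂
  have hm1 : m ≤ m₁ := min_le_left _ _
  have hm2 : m ≤ m₂ := min_le_right _ _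
  have h4 : (2 : ℝ) ≤ β ^ (m / 2) := by
    have hpow : ((4 : ℝ) ^ (2 / m)) ^ (m / 2) ≤ β ^ (m / 2) := Real.rpow_le_rpow (by positivity) hβ (by positivity)
    have h44 : ((4 : ℝ) ^ (2 / m)) ^ (m / 2) = 4 := by
      rw [← Real.rpow_mul (by norm_num)]
      have : 2 / m * (m / 2) = 1 := by field_simp
      rw [this, Real.rpow_one]
    linarith [hpow, h44]
  have key : ∀ m' : ℝ, m ≤ m' → β ^ (-(1 + 4 * A + m')) ≤ β ^ (-(1 + 4 * A + m / 2)) / 2 := by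
    intro m' hm'
    have step1 : β ^ (-(1 + 4 * A + m')) ≤ β ^ (-(1 + 4 * A + m)) := Real.rpow_le_rpow_of_exponent_le hβ1 (by linarith)
    have step2 : β ^ (-(1 + 4 * A + m)) = β ^ (-(1 + 4 * A + m / 2)) * β ^ (-(m / 2)) := by
      rw [← Real.rpow_add hβ0]; ring_nf
    have step3 : β ^ (-(m / 2)) ≤ 1 / 2 := by
      rw [Real.rpow_neg hβ0.le, show (1 : ℝ) / 2 = (2 : ℝ)⁻¹ by norm_num]
      exact inv_anti₀ (by norm_num) h4
    have pos : 0 ≤ β ^ (-(1 + 4 * A + m / 2)) := by positivity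
    calc β ^ (-(1 + 4 * A + m')) ≤ β ^ (-(1 + 4 * A + m)) := step1
      _ = β ^ (-(1 + 4 * A + m / 2)) * β ^ (-(m / 2)) := step2
      _ ≤ β ^ (-(1 + 4 * A + m / 2)) * (1 / 2) := by gcongr
      _ = β ^ (-(1 + 4 * A + m / 2)) / 2 := by ring
  have e1 := key m₁ hm1
  have e2 := key m₂ hm2
  linarith

/-- **Crux `TorusMeanNearColdBoxG` from its infrared stub alone.**  If for every compact simple `G` and lattice representation `r` there is a
top scale `0 < θ₁ ≤ 1/200` at which, for every `0 < A < θ₁`, the torus plaquette mean exceeds the centre-plaquette mean of the cold box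
`⌈β^θ₁⌉` by at most `β^{−(1+4A+m)}` (all large `β`, then all large odd tori, every plane), then `TorusMeanNearColdBoxG` holds — the nested-box
comparison down to any scale `θ ≤ θ₁` is the landed `nestedBoxMeansAgreeG`. -/
theorem torusMeanNearColdBoxG_of_topBox
    (h₁ : ∀ (G : Type) [Group G] [TopologicalSpace G] [IsTopologicalGroup G] [CompactSpace G],
      IsCompactSimpleLieGroup G →
        letI : MeasurableSpace G := borel G
        haveI : BorelSpace G := ⟨rfl⟩
        ∀ r : LatticeRep G, ∃ θ₁ : ℝ, 0 < θ₁ ∧ θ₁ ≤ 1 / 200 ∧ ∀ A : ℝ, 0 < A → A < θ₁ → ∃ m : ℝ, 0 < m ∧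
          ∃ β₀ : ℝ, ∀ β : ℝ, β₀ ≤ β → ∃ S₀ : ℕ, ∀ S : ℕ, S₀ ≤ S → ∀ i j : Fin 4, i < j →
            (∫ U, plaqCost0 r.ρ i j (torusLift (2 * S + 1) U) ∂(wilsonMeasure (d := 4) (L := 2 * S + 1) r.ρ β)) -
                (∫ U, plaqCostAt r.ρ (boxCentre ⌈β ^ θ₁⌉₊) i j U ∂(boxState r.ρ β ⌈β ^ θ₁⌉₊)) ≤
              β ^ (-(1 + 4 * A + m))) :
    TorusMeanNearColdBoxG := by
  unfold TorusMeanNearColdBoxG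
  intro G _ _ _ _ hG r
  obtain ⟨θ₁, hθ₁, hθ₁', htop⟩ := h₁ G hG r
  refine ⟨θ₁, hθ₁, ?_⟩
  intro A θ hA hAθ hθ
  obtain ⟨m₁, hm₁, β₁, hβ₁⟩ := htop A hA (lt_of_lt_of_le hAθ hθ)
  obtain ⟨m₂, hm₂, β₂, hβ₂⟩ := nestedBoxMeansAgreeG G hG r A θ θ₁ hA hAθ hθ hθ₁'
  refine ⟨min m₁ m₂ / 2, by positivity, max (max β₁ β₂) (max 1 ((4 : ℝ) ^ (2 / min m₁ m₂))), ?_⟩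
  intro β hβ
  have hb1 : β₁ ≤ β := le_trans (le_trans (le_max_left _ _) (le_max_left _ _)) hβ
  have hb2 : β₂ ≤ β := le_trans (le_trans (le_max_right _ _) (le_max_left _ _)) hβ
  have hone : (1 : ℝ) ≤ β := le_trans (le_trans (le_max_left _ _) (le_max_right _ _)) hβ
  have hfour : (4 : ℝ) ^ (2 / min m₁ m₂) ≤ β := le_trans (le_trans (le_max_right _ _) (le_max_right _ _)) hβ
  obtain ⟨S₀, hS₀⟩ := hβ₁ β hb1
  refine ⟨S₀, ?_⟩
  intro S hS i j hij
  have e1 := hS₀ S hS i j hij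
  have e2 := hβ₂ β hb2 i j hij
  have e3 := two_rpow_le (A := A) hm₁ hm₂ hone hfour
  linarith

end Summit.QuantumFields.YangMills.Theorems.SixPlaneColdBox

end
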